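import Literature.Geometry.Lorentzian.KerrConvergence
import Literature.Geometry.Lorentzian.KerrWaveEnergy

/-!
# Route EIHFluxBalance — `InertialRecession`: Lorentz-factor bookkeeping for the modulated ansatz

Helper file for the crux `stmt-FinalStateConjecture-10166`
(`Summit.FinalStateConjecture.FinalStateConjecture.Theses.EIHFluxBalance.InertialRecession`).

The hypothesis of `InertialRecession` controls the Lorentz motions `Λᵢ(t) ∈ O(1,3)` of the holes
only through the **Lorentz factor** `|(Λᵢ(t) e₀)⁰| ≤ γ`. Every estimate on the modulated
multi-Kerr–Schild ansatz `η + Σᵢ (g_{Mᵢ,aᵢ} ∘ Λᵢ(t)⁻¹(· − cᵢ(t)) − η)` (decay of the far field on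
hole-following domains, comparison of painted radii with lab distances, adiabatic errors of the
re-charting) needs this single number turned into (a) a bound on the Euclidean operator norms of
`Λᵢ(t)` and `Λᵢ(t)⁻¹`, and (b) a comparison between the painted Kerr–Schild radius
`r_{aᵢ}(Λᵢ(t)⁻¹(x − cᵢ(t)))` of a lab point on the slab `{x⁰ = t}` and its lab distance
`‖x̲ − ξᵢ(t)‖` to the centre. This file supplies exactly these, for a general `Λ ∈ lorentzGroup`:

* `lorentz_apply_zero_sq` : `((Λ e₀)⁰)² = 1 + ‖(Λ e₀)~‖²` (so the Lorentz factor is `≥ 1`,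
  `one_le_abs_lorentz_apply_zero`);
* `lorentz_symm_apply_basisVector_zero` : `(Λ⁻¹ e₀)⁰ = (Λ e₀)⁰` (same Lorentz factor for `Λ⁻¹`);
* `spatialNorm_lorentz_apply_sq` : for spatial `w` (`w⁰ = 0`), `‖(Λ w)~‖² = ‖w‖² + ((Λ w)⁰)²`
  — boosts STRETCH spatial vectors — and `abs_lorentz_apply_zero_le` : `|(Λ w)⁰| ≤ |(Λ e₀)⁰| ‖w‖`;
* `norm_lorentz_le` / `norm_lorentz_symm_le` : `‖Λ‖, ‖Λ⁻¹‖ ≤ 1 + 3 |(Λ e₀)⁰|` (Euclidean operator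
  norms on `E4`);
* `sq_sub_sq_le_radius_poincareInv_sq` : on the lab slab through the centre,
  `‖x̲ − ξ‖² − a² ≤ r_a(Λ⁻¹(x − (t, ξ)))²` — a lab point far from the painted centre has large
  painted radius, whatever the boost.

All proofs are the invariance `η(Λv, Λw) = η(v, w)` plus `η(u,u) = −(u⁰)² + ‖u~‖²` and
Cauchy–Schwarz in `E3` (O'Neill 1983, Ch. 9, pp. 233–236 for `O(1,3)`).
-/

noncomputable section

open Literature.Geometry.Lorentzian

namespace Summit.FinalStateConjecture.FinalStateConjecture.Theorems

/-! ### The Minkowski quadratic form in time/space components -/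

/-- `‖u‖² = (u⁰)² + ‖u~‖²` for the Euclidean norm of `E4` (coordinate bookkeeping). [folklore] -/
theorem norm_sq_eq_sq_add_spatialNorm_sq (u : E4) :
    ‖u‖ ^ 2 = u 0 ^ 2 + E4.spatialNorm u ^ 2 := by
  rw [EuclideanSpace.real_norm_sq_eq, Fin.sum_univ_four, E4.spatialNorm_sq]
  ring

/-- `η(u, u) = −(u⁰)² + ‖u~‖²` (O'Neill 1983, Ch. 3, p. 55). [folklore] -/
theorem minkowski_bilin_self (u : E4) :
    Minkowski.bilin u u = -(u 0) ^ 2 + E4.spatialNorm u ^ 2 := by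
  rw [Minkowski.bilin_apply, E4.spatialNorm_sq, Fin.sum_univ_three]
  simp only [Fin.succ_zero_eq_one, Fin.succ_one_eq_two]
  rw [show (2 : Fin 3).succ = (3 : Fin 4) from rfl]
  ring

/-- `η(e₀, u) = −u⁰` (O'Neill 1983, Ch. 3, p. 55). [folklore] -/
theorem minkowski_bilin_basisVector_zero_left (u : E4) :
    Minkowski.bilin (E4.basisVector 0) u = -(u 0) := by
  rw [Minkowski.bilin_apply]
  simp [Fin.succ_ne_zero]

/-- For a spatial vector `w` (`w⁰ = 0`), `η(z, w) = ⟪z~, w~⟫` (O'Neill 1983, Ch. 3, p. 55). [folklore] -/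
theorem minkowski_bilin_of_apply_zero_eq_zero (z : E4) {w : E4} (hw : w 0 = 0) :
    Minkowski.bilin z w = inner ℝ (E4.spatial z) (E4.spatial w) := by
  rw [Minkowski.bilin_apply, hw, mul_zero, neg_zero, zero_add]
  rw [show inner ℝ (E4.spatial z) (E4.spatial w) =
      ∑ i : Fin 3, inner ℝ (E4.spatial z i) (E4.spatial w i) from (PiLp.inner_apply _ _)]
  refine Finset.sum_congr rfl fun i _ ↦ ?_
  rw [E4.spatial_apply, E4.spatial_apply, real_inner_eq_re_inner]
  simp [mul_comm]

/-- A spatial vector has Euclidean norm equal to its spatial norm (bookkeeping). [folklore] -/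
theorem norm_eq_spatialNorm_of_apply_zero_eq_zero {w : E4} (hw : w 0 = 0) :
    ‖w‖ = E4.spatialNorm w := by
  have h := norm_sq_eq_sq_add_spatialNorm_sq w
  rw [hw] at h
  nlinarith [norm_nonneg w, E4.spatialNorm_nonneg w]

/-! ### Lorentz transformations: Lorentz factor, stretching, operator norm -/

/-- **The Lorentz factor identity** `((Λ e₀)⁰)² = 1 + ‖(Λ e₀)~‖²` for `Λ ∈ O(1,3)`: `Λ e₀` is a unit
timelike vector (O'Neill 1983, Ch. 9, p. 233). [folklore] -/
theorem lorentz_apply_zero_sq (Λ : lorentzGroup) :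
    ((Λ : E4 ≃L[ℝ] E4) (E4.basisVector 0)) 0 ^ 2 =
      1 + E4.spatialNorm ((Λ : E4 ≃L[ℝ] E4) (E4.basisVector 0)) ^ 2 := by
  have h := Λ.2 (E4.basisVector 0) (E4.basisVector 0)
  rw [minkowski_bilin_self, Minkowski.bilin_basisVector_zero] at h
  linarith

/-- The Lorentz factor of `Λ ∈ O(1,3)` is at least `1` (O'Neill 1983, Ch. 9, p. 233). [folklore] -/
theorem one_le_abs_lorentz_apply_zero (Λ : lorentzGroup) :
    1 ≤ |((Λ : E4 ≃L[ℝ] E4) (E4.basisVector 0)) 0| := by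
  have h := lorentz_apply_zero_sq Λ
  have h1 : 1 ≤ ((Λ : E4 ≃L[ℝ] E4) (E4.basisVector 0)) 0 ^ 2 := by
    nlinarith [sq_nonneg (E4.spatialNorm ((Λ : E4 ≃L[ℝ] E4) (E4.basisVector 0)))]
  nlinarith [abs_nonneg (((Λ : E4 ≃L[ℝ] E4) (E4.basisVector 0)) 0),
    sq_abs (((Λ : E4 ≃L[ℝ] E4) (E4.basisVector 0)) 0)]

/-- **`Λ⁻¹` has the same Lorentz factor as `Λ`**: `(Λ⁻¹ e₀)⁰ = (Λ e₀)⁰` — both equal `−η(Λ e₀, e₀)`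
by invariance (O'Neill 1983, Ch. 9, p. 233; for boosts, `γ(−v) = γ(v)`). [folklore] -/
theorem lorentz_symm_apply_basisVector_zero (Λ : lorentzGroup) :
    ((Λ : E4 ≃L[ℝ] E4).symm (E4.basisVector 0)) 0 = ((Λ : E4 ≃L[ℝ] E4) (E4.basisVector 0)) 0 := by
  have h1 := minkowski_bilin_basisVector_zero_left ((Λ : E4 ≃L[ℝ] E4).symm (E4.basisVector 0))
  have h2 := minkowski_bilin_basisVector_zero_left ((Λ : E4 ≃L[ℝ] E4) (E4.basisVector 0))
  have h3 := Λ.2 (E4.basisVector 0) ((Λ : E4 ≃L[ℝ] E4).symm (E4.basisVector 0))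
  rw [ContinuousLinearEquiv.apply_symm_apply, Minkowski.bilin_symm] at h3
  linarith

/-- The coercion of the group inverse in `lorentzGroup` is `ContinuousLinearEquiv.symm`
(Mathlib's `ContinuousLinearEquiv.automorphismGroup`). [folklore] -/
theorem coe_lorentz_inv (Λ : lorentzGroup) :
    ((Λ⁻¹ : lorentzGroup) : E4 ≃L[ℝ] E4) = (Λ : E4 ≃L[ℝ] E4).symm := rfl

/-- **Boosts stretch spatial vectors**: for `w⁰ = 0`, `‖(Λ w)~‖² = ‖w‖² + ((Λ w)⁰)²`, from
`η(Λw, Λw) = η(w, w) = ‖w‖²` (O'Neill 1983, Ch. 9, p. 233). [folklore] -/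
theorem spatialNorm_lorentz_apply_sq (Λ : lorentzGroup) {w : E4} (hw : w 0 = 0) :
    E4.spatialNorm ((Λ : E4 ≃L[ℝ] E4) w) ^ 2 = ‖w‖ ^ 2 + ((Λ : E4 ≃L[ℝ] E4) w) 0 ^ 2 := by
  have h := Λ.2 w w
  rw [minkowski_bilin_self, minkowski_bilin_self, hw] at h
  rw [norm_eq_spatialNorm_of_apply_zero_eq_zero hw]
  linarith

/-- For spatial `w`, `‖w‖ ≤ ‖(Λ w)~‖` (O'Neill 1983, Ch. 9, p. 233). [folklore] -/
theorem norm_le_spatialNorm_lorentz_apply (Λ : lorentzGroup) {w : E4} (hw : w 0 = 0) :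
    ‖w‖ ≤ E4.spatialNorm ((Λ : E4 ≃L[ℝ] E4) w) := by
  have h := spatialNorm_lorentz_apply_sq Λ hw
  refine (sq_le_sq₀ (norm_nonneg w) (E4.spatialNorm_nonneg _)).mp ?_
  nlinarith [sq_nonneg (((Λ : E4 ≃L[ℝ] E4) w) 0)]

/-- **Time component created by a boost**: for spatial `w`, `|(Λ w)⁰| ≤ |(Λ e₀)⁰| · ‖w‖`
(`(Λ w)⁰ = −η(Λ⁻¹e₀, w) = −⟪(Λ⁻¹e₀)~, w~⟫` and `‖(Λ⁻¹e₀)~‖² = ((Λe₀)⁰)² − 1`; O'Neill 1983, Ch. 9,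
p. 233). [folklore] -/
theorem abs_lorentz_apply_zero_le (Λ : lorentzGroup) {w : E4} (hw : w 0 = 0) :
    |((Λ : E4 ≃L[ℝ] E4) w) 0| ≤ |((Λ : E4 ≃L[ℝ] E4) (E4.basisVector 0)) 0| * ‖w‖ := by
  set z : E4 := (Λ : E4 ≃L[ℝ] E4).symm (E4.basisVector 0) with hz
  -- `(Λ w)⁰ = −η(e₀, Λ w) = −η(Λ z, Λ w) = −η(z, w) = −⟪z~, w~⟫`
  have h1 := minkowski_bilin_basisVector_zero_left ((Λ : E4 ≃L[ℝ] E4) w)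
  have h2 := Λ.2 z w
  rw [hz, ContinuousLinearEquiv.apply_symm_apply] at h2
  rw [← hz, minkowski_bilin_of_apply_zero_eq_zero z hw] at h2
  have h3 : ((Λ : E4 ≃L[ℝ] E4) w) 0 = -inner ℝ (E4.spatial z) (E4.spatial w) := by linarith
  -- `‖z~‖ ≤ |(Λ e₀)⁰|`
  have h4 : E4.spatialNorm z ≤ |((Λ : E4 ≃L[ℝ] E4) (E4.basisVector 0)) 0| := by
    have h5 := lorentz_apply_zero_sq Λ⁻¹
    rw [coe_lorentz_inv, ← hz, lorentz_symm_apply_basisVector_zero] at h5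
    refine (sq_le_sq₀ (E4.spatialNorm_nonneg z) (abs_nonneg _)).mp ?_
    rw [sq_abs]
    linarith
  rw [h3, abs_neg]
  calc |inner ℝ (E4.spatial z) (E4.spatial w)| ≤ ‖E4.spatial z‖ * ‖E4.spatial w‖ :=
        abs_real_inner_le_norm _ _
    _ = E4.spatialNorm z * ‖w‖ := by
        rw [norm_eq_spatialNorm_of_apply_zero_eq_zero hw]; rfl
    _ ≤ |((Λ : E4 ≃L[ℝ] E4) (E4.basisVector 0)) 0| * ‖w‖ :=
        mul_le_mul_of_nonneg_right h4 (norm_nonneg w)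

/-- **Euclidean operator norm of a Lorentz transformation in terms of its Lorentz factor**:
`‖Λ‖ ≤ 1 + 3|(Λ e₀)⁰|` (decompose `v = v⁰ e₀ + w`; `‖Λ e₀‖² = 2((Λe₀)⁰)² − 1`,
`‖Λ w‖² = ‖w‖² + 2((Λw)⁰)² ≤ (1 + 2((Λe₀)⁰)²)‖w‖²`). O'Neill 1983, Ch. 9, p. 236 (polar
decomposition; the sharp value is `|(Λe₀)⁰| + √(((Λe₀)⁰)² − 1)`). [folklore] -/
theorem norm_lorentz_le (Λ : lorentzGroup) :
    ‖((Λ : E4 ≃L[ℝ] E4) : E4 →L[ℝ] E4)‖ ≤ 1 + 3 * |((Λ : E4 ≃L[ℝ] E4) (E4.basisVector 0)) 0| := by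
  set L : E4 ≃L[ℝ] E4 := (Λ : E4 ≃L[ℝ] E4) with hL
  set γ : ℝ := |(L (E4.basisVector 0)) 0| with hγ
  have hγ1 : 1 ≤ γ := one_le_abs_lorentz_apply_zero Λ
  refine ContinuousLinearMap.opNorm_le_bound _ (by positivity) fun v ↦ ?_
  -- decomposition `v = v⁰ e₀ + w`
  set w : E4 := v - v 0 • E4.basisVector 0 with hw
  have hw0 : w 0 = 0 := by simp [hw]
  have hv : v = v 0 • E4.basisVector 0 + w := by rw [hw]; abel
  have hsw : E4.spatial w = E4.spatial v := by
    have h0 : E4.spatial (E4.basisVector 0) = 0 := by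
      ext i
      simp [E4.spatial_apply, Fin.succ_ne_zero]
    rw [hw, map_sub, map_smul, h0, smul_zero, sub_zero]
  have hnw : ‖w‖ ≤ ‖v‖ := by
    rw [norm_eq_spatialNorm_of_apply_zero_eq_zero hw0, E4.spatialNorm, hsw]
    have h := norm_sq_eq_sq_add_spatialNorm_sq v
    rw [E4.spatialNorm] at h
    nlinarith [norm_nonneg v, norm_nonneg (E4.spatial v), sq_nonneg (v 0)]
  have hv0 : |v 0| ≤ ‖v‖ := by
    have h := norm_sq_eq_sq_add_spatialNorm_sq v
    refine (sq_le_sq₀ (abs_nonneg _) (norm_nonneg v)).mp ?_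
    rw [sq_abs]
    nlinarith [sq_nonneg (E4.spatialNorm v)]
  -- `‖L e₀‖ ≤ (3/2) γ`
  have he : ‖L (E4.basisVector 0)‖ ≤ 3 / 2 * γ := by
    have h1 := norm_sq_eq_sq_add_spatialNorm_sq (L (E4.basisVector 0))
    have h2 := lorentz_apply_zero_sq Λ
    rw [← hL] at h2
    have h3 : ‖L (E4.basisVector 0)‖ ^ 2 ≤ (3 / 2 * γ) ^ 2 := by
      rw [h1, hγ, mul_pow, sq_abs]; nlinarith
    exact (sq_le_sq₀ (norm_nonneg _) (by positivity)).mp h3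
  -- `‖L w‖ ≤ (1 + 3/2 γ) ‖w‖`
  have hLw : ‖L w‖ ≤ (1 + 3 / 2 * γ) * ‖w‖ := by
    have h1 := norm_sq_eq_sq_add_spatialNorm_sq (L w)
    have h2 := spatialNorm_lorentz_apply_sq Λ hw0
    have h3 := abs_lorentz_apply_zero_le Λ hw0
    rw [← hL] at h2 h3
    rw [← hγ] at h3
    have h4 : (L w) 0 ^ 2 ≤ (γ * ‖w‖) ^ 2 := by
      rw [← sq_abs ((L w) 0)]
      exact pow_le_pow_left₀ (abs_nonneg _) h3 2
    have h5 : ‖L w‖ ^ 2 ≤ ((1 + 3 / 2 * γ) * ‖w‖) ^ 2 := by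
      rw [h1, h2]
      nlinarith [norm_nonneg w, sq_nonneg ‖w‖,
        mul_nonneg (by linarith : (0:ℝ) ≤ γ) (norm_nonneg w)]
    exact (sq_le_sq₀ (norm_nonneg _) (by positivity)).mp h5
  -- assemble
  calc ‖(L : E4 →L[ℝ] E4) v‖ = ‖v 0 • L (E4.basisVector 0) + L w‖ := by
        conv_lhs => rw [ContinuousLinearEquiv.coe_coe, hv]
        rw [map_add, map_smul]
    _ ≤ |v 0| * ‖L (E4.basisVector 0)‖ + ‖L w‖ := by
        refine (norm_add_le _ _).trans ?_
        rw [norm_smul, Real.norm_eq_abs]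
    _ ≤ ‖v‖ * (3 / 2 * γ) + (1 + 3 / 2 * γ) * ‖v‖ := by
        gcongr
        · exact (mul_le_mul_of_nonneg_left hnw (by positivity))
            |> fun h ↦ hLw.trans h
    _ = (1 + 3 * γ) * ‖v‖ := by ring

/-- `‖Λ⁻¹‖ ≤ 1 + 3|(Λ e₀)⁰|`: the inverse has the same Lorentz factor
(`lorentz_symm_apply_basisVector_zero`). O'Neill 1983, Ch. 9, p. 236. [folklore] -/
theorem norm_lorentz_symm_le' (Λ : lorentzGroup) :
    ‖((Λ : E4 ≃L[ℝ] E4).symm : E4 →L[ℝ] E4)‖ ≤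
      1 + 3 * |((Λ : E4 ≃L[ℝ] E4) (E4.basisVector 0)) 0| := by
  have h := norm_lorentz_le Λ⁻¹
  rwa [coe_lorentz_inv, lorentz_symm_apply_basisVector_zero] at h

/-- `‖Λ⁻¹‖ ≤ 1 + 3|(Λ e₀)⁰|` for every `Λ ∈ O(1,3)` — the registered sub-goal form (stub
`norm_lorentz_symm_le` of the crux item) of `norm_lorentz_symm_le'`. O'Neill 1983, Ch. 9, p. 236.
[folklore] -/
theorem norm_lorentz_symm_le : open Literature.Geometry.Lorentzian in ∀ (Λ : lorentzGroup), ‖((Λ : E4 ≃L[ℝ] E4).symm : E4 →L[ℝ] E4)‖ ≤ 1 + 3 * |((Λ : E4 ≃L[ℝ] E4) (E4.basisVector 0)) 0| :=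
  norm_lorentz_symm_le'

/-! ### Painted Kerr–Schild radius versus lab distance on the slab through the centre -/

/-- On the lab slab `{x⁰ = t}`, the rest-frame position `Λ⁻¹(x − (t, ξ))` of a lab point `x`
relative to the centre `(t, ξ)` is the image of the SPATIAL vector `(0, x̲ − ξ)`, whose norm is the
lab distance `‖x̲ − ξ‖` (bookkeeping for `poincareInv`, O'Neill 1983, Ch. 9, p. 236). [folklore] -/
theorem sub_ofTimeSpace_apply_zero {x : E4} {t : ℝ} (hx : x 0 = t) (ξ : E3) :
    (x - E4.ofTimeSpace t ξ) 0 = 0 ∧ ‖x - E4.ofTimeSpace t ξ‖ = ‖E4.spatial x - ξ‖ := by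
  have h0 : (x - E4.ofTimeSpace t ξ) 0 = 0 := by
    simp [hx]
  refine ⟨h0, ?_⟩
  have hs : E4.spatial (E4.ofTimeSpace t ξ) = ξ := by
    ext i
    simp
  rw [norm_eq_spatialNorm_of_apply_zero_eq_zero h0, E4.spatialNorm, map_sub, hs]

/-- **Far in the lab ⇒ far in every painted frame**: on the lab slab through the centre,
`‖x̲ − ξ‖² − a² ≤ r_a(Λ⁻¹(x − (t, ξ)))²` for every `Λ ∈ O(1,3)` — boosts only stretch the spatial
separation (`norm_le_spatialNorm_lorentz_apply`) and `‖y~‖² − a² ≤ r_a(y)²`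
(`Kerr.spatialNorm_sq_sub_sq_le_radius_sq`). Used to see that hole-following lab balls of radius
`R′ → ∞` eventually contain every painted near zone `{r ≤ R}` and lie inside the chart domain
`{r > rin}`. [folklore] -/
theorem sq_sub_sq_le_radius_poincareInv_sq (Λ : lorentzGroup) (a t : ℝ) (ξ : E3) {x : E4}
    (hx : x 0 = t) :
    ‖E4.spatial x - ξ‖ ^ 2 - a ^ 2 ≤
      Kerr.radius a (poincareInv Λ (E4.ofTimeSpace t ξ) x) ^ 2 := by
  obtain ⟨h0, hn⟩ := sub_ofTimeSpace_apply_zero hx ξ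
  have h1 := norm_le_spatialNorm_lorentz_apply Λ⁻¹ h0
  rw [coe_lorentz_inv, hn] at h1
  have h2 := Kerr.spatialNorm_sq_sub_sq_le_radius_sq a (poincareInv Λ (E4.ofTimeSpace t ξ) x)
  have h3 : E4.spatialNorm (poincareInv Λ (E4.ofTimeSpace t ξ) x) =
      E4.spatialNorm ((Λ : E4 ≃L[ℝ] E4).symm (x - E4.ofTimeSpace t ξ)) := rfl
  rw [h3] at h2
  nlinarith [norm_nonneg (E4.spatial x - ξ)]

end Summit.FinalStateConjecture.FinalStateConjecture.Theorems

end
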